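import Literature.MathematicalPhysics.QuantumLattice.SectorChartPoint
import HarnessLib

/-!
# The master symbol: the rescaled sector symbol as a value of a scale-smooth function
(Benfatto–Giuliani–Mastropietro 2006, Lemma 2.2: the `h`-uniform symbol estimates, part 2)

Topic `Literature/MathematicalPhysics/QuantumLattice`; continues `SectorChartPoint.lean`. There the
chart point `k(θ₀,a,b;s) = p_F + s²a n + sb τ`, the rescaled dispersion `Ẽ` (`ε(k) - μ = s²Ẽ`) and
the rescaled truncated relative angle `Ã` (`angFun = sÃ`) were constructed as SMOOTH functions of
`(θ₀, a, b, s)` down to `s = 0`. Here they are assembled into the **master symbol**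

  `Φ̂(θ₀,a,b; t₀; s) = G(√(t₀² + Ẽ²)) · ψ(u) · W(Ã/π) · χ(k) · conj(D̃) · η(|D̃|²)`,

`G = gnShell 4 e₀ 0` the `h`-free shell profile (`f_{-n}(|D|) = G(4ⁿ|D|)`, `scaleCutoffFn_eq_gnShell_zero`),
`ψ = truncOne`, `W = sectorUnitWeight`, `χ = zoneBump`, `D̃ = -it₀ + Ẽ` the rescaled denominator
(`D = 4^{-n}D̃`) and `η = sectorInvCutoff (e₀/16)²` a smooth function equal to `1/q` on `q ≥ (e₀/16)²/2`
(so `conj(D̃)η(|D̃|²) = 1/D̃` wherever the shell profile is nonzero), and the central identity is PROVED: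

  **`rescaledSectorSymbol e₀ n ω (t) = 4ⁿ · Φ̂(θ_{n,ω}, t₁, t₂; t₀; 2^{-n})`** (`rescaledSectorSymbol_eq_masterSymbol`)

for `0 < e₀ ≤ (4+μ)/2` — the rescaled symbol of `SectorPropagatorFourier` is `γ^{-h}` times the value
at `s = γ^{h/2}` of ONE function of `(θ₀, t, s)`, smooth in all variables (the smoothness is the
subject of the sequel): this is how the `h`-uniformity of BGM's Lemma 2.2 ("the bounds (2.50),
(2.52) hold uniformly in `h`") is obtained without order-by-order derivative bookkeeping. The case
analysis of the identity: off the shell or off the zone both sides vanish; on them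
`√((4+μ)/2) ≤ |k⃗| ≤ π/2`, the angular cutoff is `W(Θ/w_n)` with `Θ = arg u` the relative angle
(`sectorWeightCirc_polarAngle_eq`), `Ã/π = truncArg(u)/w_n`, and `truncArg(u) = arg u`, `ψ(u) = 1`
for `|arg u| ≤ 3π/4`, while for `|arg u| > 3π/4` both angular factors vanish.

Everything is PROVED; the definitions are `sectorInvCutoff`, `rescaledDenom`, `masterSymbol`.

## Sources

* G. Benfatto, A. Giuliani, V. Mastropietro, Ann. Henri Poincaré 7 (2006) 809–898, §2.5
  (2.46)–(2.52), Lemma 2.2 and its `h`-uniformity (arXiv:cond-mat/0507686 pp. 10–11). [BenfattoGiulianiMastropietro2006]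
* G. Benfatto, A. Giuliani, V. Mastropietro, Ann. Henri Poincaré 4 (2003) 137–193, §7.2 (proof
  of Lemma 3.1). [BenfattoGiulianiMastropietro2003]
-/

noncomputable section

open Real Set Complex Function
open scoped Topology ComplexConjugate
open Literature.Analysis.Calculus Literature.Analysis.SpecialFunctions

namespace Literature.MathematicalPhysics.QuantumLattice

/-! ### The inverse cutoff -/

/-- The smooth inverse `η(q) = S((4q - q₀)/q₀) q⁻¹`: `= q⁻¹` on `q ≥ q₀/2`, `= 0` on `q ≤ q₀/4`. [folklore] -/
def sectorInvCutoff (q₀ q : ℝ) : ℝ := Real.smoothTransition ((4 * q - q₀) / q₀) * q⁻¹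

/-- `η = q⁻¹` on `q ≥ q₀/2`. [folklore] -/
theorem sectorInvCutoff_eq_inv {q₀ : ℝ} (hq₀ : 0 < q₀) {q : ℝ} (h : q₀ / 2 ≤ q) : sectorInvCutoff q₀ q = q⁻¹ := by
  rw [sectorInvCutoff, Real.smoothTransition.one_of_one_le, one_mul]
  rw [le_div_iff₀ hq₀]; linarith

/-- `η = 0` on `q ≤ q₀/4`. [folklore] -/
theorem sectorInvCutoff_eq_zero {q₀ : ℝ} (hq₀ : 0 < q₀) {q : ℝ} (h : q ≤ q₀ / 4) : sectorInvCutoff q₀ q = 0 := by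
  rw [sectorInvCutoff, Real.smoothTransition.zero_of_nonpos, zero_mul]
  exact div_nonpos_of_nonpos_of_nonneg (by linarith) hq₀.le

/-- `η` is smooth. [folklore] -/
theorem contDiff_sectorInvCutoff {q₀ : ℝ} (hq₀ : 0 < q₀) {n : ℕ∞} : ContDiff ℝ n (sectorInvCutoff q₀) := by
  refine contDiff_iff_contDiffAt.2 fun q => ?_
  rcases eq_or_ne q 0 with rfl | hq
  · -- near `0` the transition factor vanishes identically
    have hev : sectorInvCutoff q₀ =ᶠ[𝓝 (0 : ℝ)] fun _ => 0 := by
      have : Iio (q₀ / 4) ∈ 𝓝 (0 : ℝ) := Iio_mem_nhds (by linarith)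
      filter_upwards [this] with q hq
      exact sectorInvCutoff_eq_zero hq₀ (le_of_lt hq)
    exact (contDiffAt_const (c := (0 : ℝ))).congr_of_eventuallyEq hev
  · exact (Real.smoothTransition.contDiff.comp (((contDiff_const.mul contDiff_id).sub contDiff_const).div_const _)).contDiffAt.mul
      (contDiffAt_inv ℝ hq)

/-! ### The shell profile at scale zero -/

/-- **Support of the `h`-free shell profile**: `G(r) ≠ 0 ⟹ e₀/16 < r < e₀`. [cite: BenfattoGiulianiMastropietro2006, §2.3 (2.28)] -/
theorem mem_Ioo_of_gnShell_zero_ne_zero {e₀ : ℝ} (he : 0 < e₀) {r : ℝ} (h : gnShell 4 e₀ 0 r ≠ 0) :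
    r ∈ Ioo (e₀ / 16) e₀ := by
  have h1 := mem_Ioo_of_gnShell_ne_zero (γ := (4 : ℝ)) (by norm_num) he h
  simp only [zero_sub, zpow_zero, mul_one] at h1
  have h2 : e₀ * (4 : ℝ) ^ (-2 : ℤ) = e₀ / 16 := by
    rw [zpow_neg, show ((4 : ℝ) ^ (2 : ℤ)) = 16 by norm_num]; ring
  rwa [h2] at h1

/-- **`f_{-n}(|D|) = G(4ⁿ|D|)`**: the single-scale cutoff is the `h`-free shell profile of the rescaled
denominator. [cite: BenfattoGiulianiMastropietro2006, §2.3 (2.28)] -/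
theorem scaleCutoffFn_eq_gnShell_zero (e₀ μ : ℝ) (n : ℕ) (p : ℝ × (Fin 2 → ℝ)) :
    scaleCutoffFn e₀ μ n p = gnShell 4 e₀ 0 ((4 : ℝ) ^ n * Real.sqrt (p.1 ^ 2 + (sqDispersion p.2 - μ) ^ 2)) := by
  simp only [scaleCutoffFn, gnShell, gnScaleCutoff, neg_neg, zpow_natCast, neg_zero, zpow_zero, one_mul, zero_sub]
  congr 2
  rw [show -(-(n : ℤ) - 1) = (n : ℤ) + 1 by ring, zpow_add_one₀ (by norm_num : (4 : ℝ) ≠ 0), zpow_natCast]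
  simp only [zpow_one]
  ring

/-! ### The master symbol -/

/-- The rescaled denominator `D̃ = -it₀ + Ẽ` (`D = 4^{-n} D̃`). [cite: BenfattoGiulianiMastropietro2006, §2.5 (2.49)] -/
def rescaledDenom (μ : ℝ) (x : ℝ × ℝ × ℝ) (t₀ s : ℝ) : ℂ := -(I * (t₀ : ℂ)) + (rescaledDispersion μ (x, s) : ℂ)

/-- `|D̃|² = t₀² + Ẽ²`. [folklore] -/
theorem normSq_rescaledDenom (μ : ℝ) (x : ℝ × ℝ × ℝ) (t₀ s : ℝ) :
    Complex.normSq (rescaledDenom μ x t₀ s) = t₀ ^ 2 + rescaledDispersion μ (x, s) ^ 2 := by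
  rw [rescaledDenom, Complex.normSq_apply]
  simp
  ring

/-- **The master symbol** `Φ̂(θ₀,a,b; t₀; s) = G(√(t₀²+Ẽ²)) ψ(u) W(Ã/π) χ(k) conj(D̃) η(|D̃|²)`. [cite: BenfattoGiulianiMastropietro2006, §2.5 Lemma 2.2] -/
def masterSymbol (μ e₀ : ℝ) (x : ℝ × ℝ × ℝ) (t₀ s : ℝ) : ℂ :=
  ((gnShell 4 e₀ 0 (Real.sqrt (t₀ ^ 2 + rescaledDispersion μ (x, s) ^ 2)) *
        truncOne (2 * truncRadius μ) (Real.cos (3 * π / 4)) (Real.cos (7 * π / 8)) (sectorUFun μ x s) *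
        sectorUnitWeight (rescaledAngle μ (x, s) / π) * zoneBump (sectorChartPoint μ x s) : ℝ) : ℂ) *
    (conj (rescaledDenom μ x t₀ s) * (sectorInvCutoff ((e₀ / 16) ^ 2) (Complex.normSq (rescaledDenom μ x t₀ s)) : ℂ))

/-- `cos(7π/8) < cos(3π/4)`. [folklore] -/
theorem cos_seven_lt_cos_three : Real.cos (7 * π / 8) < Real.cos (3 * π / 4) :=
  Real.cos_lt_cos_of_nonneg_of_le_pi (by positivity) (by linarith [pi_pos]) (by linarith [pi_pos])

section Identity

variable {μ : ℝ} (hμ₁ : -4 < μ) (hμ₂ : μ < -2 - Real.sqrt 2)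
include hμ₁ hμ₂

omit hμ₁ hμ₂ in
/-- `2 · truncRadius = √((4+μ)/2)`, the inner radius of the shells. [folklore] -/
theorem two_mul_truncRadius : 2 * truncRadius μ = Real.sqrt ((4 + μ) / 2) := by
  unfold truncRadius; ring

/-- **The central identity**: `rescaledSectorSymbol e₀ n ω t = 4ⁿ · Φ̂(θ_{n,ω}, t₁, t₂; t₀; 2^{-n})` for
`0 < e₀ ≤ (4+μ)/2`. [cite: BenfattoGiulianiMastropietro2006, §2.5 Lemma 2.2] -/
theorem rescaledSectorSymbol_eq_masterSymbol {e₀ : ℝ} (he : 0 < e₀) (he' : e₀ ≤ (4 + μ) / 2) (n : ℕ) (ω : ℤ)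
    (t : MomSpace) :
    rescaledSectorSymbol hμ₁ hμ₂ e₀ n ω t =
      (((4 : ℝ) ^ n : ℝ) : ℂ) * masterSymbol μ e₀ (((ω : ℝ) + 1 / 2) * sectorWidth n, t 1, t 2) (t 0) ((2 : ℝ) ^ (-(n : ℤ))) := by
  -- notation
  set θ₀ : ℝ := ((ω : ℝ) + 1 / 2) * sectorWidth n with hθ₀
  set s : ℝ := (2 : ℝ) ^ (-(n : ℤ)) with hs
  set x : ℝ × ℝ × ℝ := (θ₀, t 1, t 2) with hx
  have hspos : 0 < s := zpow_pos (by norm_num) _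
  have hs1 : s ≤ 1 := zpow_le_one_of_nonpos₀ (by norm_num) (by simp)
  have hs2 : s ^ 2 = (4 : ℝ) ^ (-(n : ℤ)) := by
    rw [hs, ← zpow_natCast, ← zpow_mul, show (4 : ℝ) = 2 ^ (2 : ℤ) by norm_num, ← zpow_mul]; congr 1; ring
  have h4pos : 0 < (4 : ℝ) ^ (-(n : ℤ)) := zpow_pos (by norm_num) _
  have h44 : (4 : ℝ) ^ n * (4 : ℝ) ^ (-(n : ℤ)) = 1 := by rw [zpow_neg, zpow_natCast, mul_inv_cancel₀ (by positivity)]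
  have hw : sectorWidth n = π * s := by rw [sectorWidth, hs, zpow_neg, zpow_natCast, div_eq_mul_inv]
  -- unfold the rescaled symbol at the split point
  have hsplit := splitMomentum_fermiBasePoint_add_sectorChart hμ₁ hμ₂ θ₀ n t
  change sectorSymbol e₀ μ n ω (splitMomentum (fermiBasePoint μ θ₀ + sectorChart hμ₁ hμ₂ θ₀ n t)) = _
  rw [hsplit]
  set k : Fin 2 → ℝ := sectorChartPoint μ x s with hk
  -- the rescaled quantities
  set E : ℝ := rescaledDispersion μ (x, s) with hE
  set Dt : ℂ := rescaledDenom μ x (t 0) s with hDt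
  have hEeq : sqDispersion k - μ = s ^ 2 * E := sectorEpsFun_eq_sq_mul_rescaledDispersion hμ₁ hμ₂ x s
  have hD : sectorDenom μ ((4 : ℝ) ^ (-(n : ℤ)) * t 0, k) = (((4 : ℝ) ^ (-(n : ℤ)) : ℝ) : ℂ) * Dt := by
    rw [sectorDenom, hDt, rescaledDenom]
    simp only
    rw [hEeq, hs2]
    push_cast
    ring
  have hρ : (4 : ℝ) ^ n * Real.sqrt (((4 : ℝ) ^ (-(n : ℤ)) * t 0) ^ 2 + (sqDispersion k - μ) ^ 2) = Real.sqrt (t 0 ^ 2 + E ^ 2) := by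
    rw [hEeq, hs2, show (((4 : ℝ) ^ (-(n : ℤ))) * t 0) ^ 2 + ((4 : ℝ) ^ (-(n : ℤ)) * E) ^ 2 =
      ((4 : ℝ) ^ (-(n : ℤ))) ^ 2 * (t 0 ^ 2 + E ^ 2) by ring, Real.sqrt_mul (sq_nonneg _), Real.sqrt_sq h4pos.le,
      ← mul_assoc, h44, one_mul]
  have hshell : scaleCutoffFn e₀ μ n ((4 : ℝ) ^ (-(n : ℤ)) * t 0, k) = gnShell 4 e₀ 0 (Real.sqrt (t 0 ^ 2 + E ^ 2)) := by
    rw [scaleCutoffFn_eq_gnShell_zero, hρ]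
  -- the two sides, written out
  have hLHS : sectorSymbol e₀ μ n ω ((4 : ℝ) ^ (-(n : ℤ)) * t 0, k) =
      ((gnShell 4 e₀ 0 (Real.sqrt (t 0 ^ 2 + E ^ 2)) * sectorWeightCirc n ω (polarAngle k) * zoneBump k : ℝ) : ℂ) /
        ((((4 : ℝ) ^ (-(n : ℤ)) : ℝ) : ℂ) * Dt) := by
    rw [sectorSymbol, hD, anisotropicCutoff, hshell]
  rw [hLHS, masterSymbol]
  simp only [← hE, ← hDt, ← hk]
  -- Case 1: off the shell
  by_cases hG : gnShell 4 e₀ 0 (Real.sqrt (t 0 ^ 2 + E ^ 2)) = 0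
  · rw [hG]; simp
  -- on the shell: `|D̃| ∈ (e₀/16, e₀)`, `conj(D̃) η = D̃⁻¹`
  have hmem := mem_Ioo_of_gnShell_zero_ne_zero he hG
  have hnSq : Complex.normSq Dt = t 0 ^ 2 + E ^ 2 := by rw [hDt, normSq_rescaledDenom]
  have hq₀ : 0 < (e₀ / 16) ^ 2 := by positivity
  have hnSq_ge : (e₀ / 16) ^ 2 / 2 ≤ Complex.normSq Dt := by
    rw [hnSq]
    have h1 : (e₀ / 16) ^ 2 < Real.sqrt (t 0 ^ 2 + E ^ 2) ^ 2 := by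
      have := hmem.1
      have h0 : 0 ≤ e₀ / 16 := by positivity
      nlinarith [Real.sqrt_nonneg (t 0 ^ 2 + E ^ 2)]
    rw [Real.sq_sqrt (by positivity)] at h1
    linarith
  have hDt0 : Dt ≠ 0 := by
    intro h0; rw [h0, map_zero] at hnSq_ge; linarith
  have hinv : conj Dt * (sectorInvCutoff ((e₀ / 16) ^ 2) (Complex.normSq Dt) : ℂ) = Dt⁻¹ := by
    rw [sectorInvCutoff_eq_inv hq₀ hnSq_ge, Complex.inv_def]
  rw [hinv]
  -- Case 2: off the zone
  by_cases hχ : zoneBump k = 0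
  · rw [hχ]; simp
  -- on the zone: `√((4+μ)/2) ≤ |k| ≤ π/2`, `k ≠ 0`
  have hkπ : ‖momToComplex k‖ ≤ π / 2 := norm_le_of_zoneBump_ne_zero hχ
  have hsc : scaleCutoffFn e₀ μ n ((4 : ℝ) ^ (-(n : ℤ)) * t 0, k) ≠ 0 := by rwa [hshell]
  have hR₀ : Real.sqrt ((4 + μ) / 2) ≤ ‖momToComplex k‖ := sqrt_le_norm_of_scaleCutoffFn_ne_zero he he' hsc
  have hR₀pos : 0 < Real.sqrt ((4 + μ) / 2) := Real.sqrt_pos.2 (by linarith)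
  have hk0 : k ≠ 0 := by
    intro h0
    rw [h0, (momToComplex_eq_zero_iff 0).2 rfl, norm_zero] at hR₀
    linarith
  -- the angular cutoff through the relative angle `arg u`
  set u : ℂ := sectorUFun μ x s with hu
  have hu0 : u ≠ 0 := by
    rw [hu, ← norm_pos_iff, norm_sectorUFun]; exact hR₀pos.trans_le hR₀
  have hζ : sectorWeightCirc n ω (polarAngle k) = sectorUnitWeight (arg u / sectorWidth n) := by
    rw [hu, arg_sectorUFun]
    exact sectorWeightCirc_polarAngle_eq n ω hk0
  have hnu : 2 * truncRadius μ ≤ ‖u‖ := by rw [two_mul_truncRadius, hu, norm_sectorUFun]; exact hR₀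
  have hru : truncRadius μ ≤ ‖u‖ := by linarith [truncRadius_pos hμ₁ (μ := μ)]
  have hÃ : rescaledAngle μ (x, s) / π = truncArg (truncRadius μ) (Real.cos (7 * π / 8)) (Real.cos (15 * π / 16)) u / sectorWidth n := by
    have h1 := sectorAngFun_eq_mul_rescaledAngle hμ₁ hμ₂ x s
    rw [sectorAngFun] at h1
    simp only at h1
    rw [← hu] at h1
    rw [hw, h1]
    field_simp
  rw [hζ, hÃ]
  -- Case 3: the relative angle
  by_cases harg : |arg u| ≤ 7 * π / 8
  · have htr : truncArg (truncRadius μ) (Real.cos (7 * π / 8)) (Real.cos (15 * π / 16)) u = arg u :=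
      truncArg_eq_arg_of_abs_arg_le (truncRadius_pos hμ₁) cos_fifteen_lt_cos_seven (by linarith [pi_pos]) le_rfl hru harg
    rw [htr]
    by_cases harg2 : |arg u| ≤ 3 * π / 4
    · -- the generic point: `ψ(u) = 1`
      have hone : truncOne (2 * truncRadius μ) (Real.cos (3 * π / 4)) (Real.cos (7 * π / 8)) u = 1 :=
        truncOne_eq_one_of_abs_arg_le (by linarith [truncRadius_pos hμ₁ (μ := μ)]) cos_seven_lt_cos_three (by linarith [pi_pos])
          le_rfl hnu harg2
      rw [hone, mul_one]
      have h44c : (((4 : ℝ) ^ n : ℝ) : ℂ) * (((4 : ℝ) ^ (-(n : ℤ)) : ℝ) : ℂ) = 1 := by exact_mod_cast h44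
      rw [div_eq_mul_inv, mul_inv, ← eq_inv_of_mul_eq_one_left h44c]
      ring
    · -- `3π/4 < |arg u| ≤ 7π/8`: the angular profile vanishes on both sides
      push Not at harg2
      have hW : sectorUnitWeight (arg u / sectorWidth n) = 0 := by
        apply sectorUnitWeight_eq_zero
        rw [abs_div, abs_of_pos (sectorWidth_pos n), le_div_iff₀ (sectorWidth_pos n), hw]
        nlinarith [pi_pos, abs_nonneg (arg u)]
      rw [hW]; simp
  · -- `|arg u| > 7π/8`: `ψ(u) = 0` and the angular profile vanishes
    push Not at harg
    have hψ : truncOne (2 * truncRadius μ) (Real.cos (3 * π / 4)) (Real.cos (7 * π / 8)) u = 0 :=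
      truncOne_eq_zero_of_le_abs_arg cos_seven_lt_cos_three (by positivity) le_rfl hu0 harg.le
    have hW : sectorUnitWeight (arg u / sectorWidth n) = 0 := by
      apply sectorUnitWeight_eq_zero
      rw [abs_div, abs_of_pos (sectorWidth_pos n), le_div_iff₀ (sectorWidth_pos n), hw]
      nlinarith [pi_pos, abs_nonneg (arg u)]
    rw [hψ, hW]; simp

end Identity

end Literature.MathematicalPhysics.QuantumLattice

end
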